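import Literature.NumberTheory.EllipticCurves.HeegnerModuleIndex
import HarnessLib

/-!
# Castella–Grossi–Lee–Skinner 2022, Theorem 4.1.3 (with Remark 4.1.4): Howard's Heegner-point
# Kolyvagin-system divisibility for `E/ℚ` over an imaginary quadratic `K` of ANY class number,
# under `E(K)[p] = 0` alone, in `Λ[1/p, 1/(γ-1)]` (in `Λ[1/p]` at corank one) — and the
# `d(k)`-shifted, `α`-stabilised `Λ`-adic Heegner class `κ_∞` it is stated with

Topic `NumberTheory/EllipticCurves`. ONE named fact (`def … : Prop`, D-0014; nothing asserted) and the
DEFINITIONS (with bodies) of the object it is stated with, in the vocabulary of the tree's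
`HeegnerModuleIndex.lean` (`LambdaAdicSelmerData`, `SelmerDualData`, `IsHeegnerNormPoint`,
`ringClassSubgroup`, `kummerClassOver`, `padicPi`, `conjPi`) and in the exact SHAPE of the tree's
records of the same theorem at `p ∤ h_K`: `Howard2004_thmB` (big image), BCK21
`thm31_howardThmB_of_irreducible` (residual irreducibility), MZ26
`cor46_howardDivisibility_of_scalarImage` (scalars in the image) and CGS25
`thm652_rankOne_charIdeal_torsion_eq_sq_dvd` (`E(K)[p] = 0`, in `Λ[1/p]`, typed with the EXTRA
binder `p ∤ h_K` and a `TODO(general form)`). This file is that general form: NO class-number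
hypothesis, because the Heegner class is built from the `d(k)`-SHIFTED tower `K[p^{d(k)}] ⊇ K_k`.

F. Castella, G. Grossi, J. Lee, C. Skinner, *On the anticyclotomic Iwasawa theory of rational elliptic
curves at Eisenstein primes*, Invent. Math. **227** (2022) 517–580 = arXiv:2008.02571v2
[CastellaGrossiLeeSkinner2022]; REFEREED / PUBLISHED. Text of record: the authors' final TeX
(`run/shared/lean/b2b/bsd-rank1-residual/b2b-bsdres-lit-cgls/src/cgls22-v2final/Eisenstein.tex`,
locators `[TeX Lnnnn]`, PUBLISHED numbering: `\newtheorem{theorem}[subsection]`); the store copy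
`paper:arxiv-2008.02571` is arXiv v1 with the older numbering (v1 "Thm. 3.4.1 / Thm. 4.1" = published
Thm. 3.4.1 / Thm. 4.1.1; v1 has no separately numbered 4.1.3). Cell `bsd-print-x9` (D-0131 (2) PRINT
TIER; leaves `ClassX9`/`ClassX10b`), seat `lit` g19, 2026-08-28, on the planner's line
`torsion-depth(-light)` want (stub `stub_depthPos_localized` of cruxes 23161 / 24424). HONEST FRAMING:
typed ≠ proved ≠ endorsed; nothing here moves a class; BSD is not proved by any of this.

## The printed statements, verbatim

* **§3.2 standing** [TeX L1253–1258]: "Let `E/ℚ` be an elliptic curve of conductor `N`, let `p ∤ 2N`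
  be a prime of good ordinary reduction for `E`, and let `K` be an imaginary quadratic field of
  discriminant `D_K` prime to `Np`. We assume (h1) `E(K)[p] = 0`." `Γ = Gal(K_∞/K)` is the Galois group
  of the ANTICYCLOTOMIC `ℤ_p`-extension [L1260]; `γ ∈ Γ` a topological generator [L2117].
* **§3.4 setting** [L2077–2117]: `Λ = ℤ_p⟦Γ⟧`, `M_E := T_pE ⊗ Λ^∨`, `𝐓 := M_E^∨(1) ≃ T_pE ⊗ Λ`; the
  ordinary Selmer structure `𝓕_Λ` (at `w ∣ p` the image of `H¹(K_w, Fil⁺_w)`; at `w ∤ p`: `0` on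
  `M_E`, all of `H¹(K_w, 𝐓)` on `𝐓`); `𝒳 := H¹_{𝓕_Λ}(K, M_E)^∨`; `𝔓₀ := (γ - 1)`.
* **§4.1 standing** [L2186]: "Let `E`, `p`, and `K` be as in §3.2, and assume in addition that
  hypotheses (Heeg) and (disc) hold" — (Heeg) [L211–212] "every prime `ℓ ∣ N` splits in `K`",
  (disc) [L248–249] "the discriminant `D_K` of `K` is odd and `D_K ≠ -3`"; `𝔑 ⊂ 𝒪_K` with
  `𝒪_K/𝔑 = ℤ/Nℤ`, `x_m ∈ X₀(N)(K[m])` the CM point of conductor `m` prime to `N`, `π : X₀(N) → E` a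
  modular parametrisation, `P[m] := π(x_m) ∈ E(K[m])` [L2186–2200].
* **Theorem 4.1.1** [L2203–2206]: "Assume `E(K)[p] = 0`. Then there exists a Kolyvagin system
  `κ^{Hg} ∈ 𝐊𝐒(𝐓, 𝓕_Λ, 𝓛_E)` such that `κ₁^{Hg} ∈ H¹_{𝓕_Λ}(K, 𝐓)` is nonzero." Proof [L2208–2249]:
  "Under the additional hypotheses that `p ∤ h_K` … and … `G_K → Aut_{ℤ_p}(T)` is surjective, this is
  [How04, Thm. 2.3.1]. … Let `K_k` be the subfield of `K_∞` with `[K_k : K] = p^k`. For each `n ∈ 𝒩`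
  set **`P_k[n] := Norm_{K[np^{d(k)}]/K_k[n]}(P[np^{d(k)}]) ∈ E(K_k[n])`, where
  `d(k) = min{d ∈ ℤ_{≥0} : K_k ⊂ K[p^{d(k)}]}`**, and `K_k[n]` denotes the compositum of `K_k` and
  `K[n]` … the arguments proving Lemma 2.3.4 (in the case `v ∣ p`) apply almost *verbatim* in the
  case when `p` divides the class number of `K`. Finally, that `κ₁^{Hg}` is nonzero follows from the
  works of Cornut and Vatsal."
* **Theorem 4.1.3** [L2253–2261] ("Applying Theorem 3.4.1 and Corollary 3.4.2 to the Kolyvagin system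
  `κ^{Hg}` of Theorem 4.1.1, we thus obtain the following."): "Assume `E(K)[p] = 0`. Then the module
  `H¹_{𝓕_Λ}(K, 𝐓)` has `Λ`-rank one, and there is a finitely generated torsion `Λ`-module `M` such that
  (i) `𝒳 ∼ Λ ⊕ M ⊕ M`, (ii) `char_Λ(M)` divides `char_Λ(H¹_{𝓕_Λ}(K, 𝐓)/Λκ₁^{Hg})` in
  `Λ[1/p, 1/(γ-1)]`. Moreover, if `H¹_𝓕(K, E[p^∞])` has `ℤ_p`-corank one, then `char_Λ(M)` divides
  `char_Λ(H¹_{𝓕_Λ}(K, 𝐓)/Λκ₁^{Hg})` in `Λ[1/p]`." (Thm. 3.4.1 [L2119–2127] and Cor. 3.4.2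
  [L2171–2178] are the same two statements for an abstract Kolyvagin system `κ` with `κ₁ ≠ 0`.)
* **Remark 4.1.4** [L2262–2294]: "Denote by `α` the `p`-adic unit root of `x² - a_p x + p`. … define
  the *`α`-stabilized Heegner point* `P[p^k]_α ∈ E(K[p^k]) ⊗ ℤ_p` by `P[p^k]_α := P[p^k] - α⁻¹P[p^{k-1}]`
  if `k ≥ 1`, `u_K⁻¹(1 - α⁻¹σ_p)(1 - α⁻¹σ_p^*)P[1]` if `k = 0` and `p` splits in `K`,
  `u_K⁻¹(1 - α⁻²)P[1]` if `k = 0` and `p` is inert in `K`. Using the Heegner point norm relations, a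
  straightforward calculation shows that the points `α^{-k}P[p^k]_α` are norm-compatible. Letting
  `δ : E(K_k) ⊗ ℤ_p → H¹(K_k, T_pE)` be the Kummer map, we may therefore set
  `κ_∞ := lim←_k δ(κ_k) ∈ lim←_k H¹(K_k, T_pE) ≃ H¹(K, 𝐓)`, where
  **`κ_k = α^{-d(k)} Norm_{K[p^{d(k)}]/K_k}(P[p^{d(k)}]_α)`**. The inclusion `κ_∞ ∈ H¹_{𝓕_Λ}(K, 𝐓)`
  follows immediately from the construction. … **In particular, `κ_∞` and `κ₁^{Hg}` generate the same
  `Λ`-submodule of `H¹_{𝓕_Λ}(K, 𝐓)`.**"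

## Transcription (weaker than print, never stronger) and the ONE design decision

* `H¹_{𝓕_Λ}(K, 𝐓) ≃ lim←_k H¹(K_k, T_pE)` with the ordinary conditions `∼ lim← S_p(E/K_k)` is a
  `LambdaAdicSelmerData` `D` (`D.S`); `𝒳 = H¹_{𝓕_Λ}(K, M_E)^∨ ∼ Sel_{p^∞}(E/K_∞)^∨` a `SelmerDualData` `X`
  (`X.X`); these are the SAME identifications the tree made for `Howard2004_thmB` / `thm31_…` /
  `cor46_…` / `thm652_…` (HeegnerModuleIndex "Design notes"; CGS25 §6.5 "the modules `𝒳`,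
  `H¹_{𝓕_Λ}(K,𝐓)` in [CGLS22, §3.4] are the same as the modules `𝔛_ord(E/K_∞⁻)` and `𝔖_ord(E/K_∞⁻)`")
  — inherited, not re-decided. `𝒳 ∼ Λ ⊕ M ⊕ M` is recorded through its invariants `rank_Λ 𝒳 = 1` and
  `char_Λ(𝒳_{Λ-tors}) = char_Λ(M)²`; "divides in `Λ[1/p, 1/(γ-1)]`" as "divides `(p^m)(T^n)·(–)` in `Λ`
  for some `m n`" (`T = γ - 1` acts on `D.S` and `X.X` by `proj_X` / `toDual_T_smul`; the ideals are
  principal in the UFD `Λ`); `H¹_𝓕(K, E[p^∞])` of `ℤ_p`-corank one ↔ the tree's `selmerCorank` of `E/K`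
  equal to `1`. Torsion-freeness of `H¹_{𝓕_Λ}(K,𝐓)` is NOT asserted by Thm. 4.1.3 and is not recorded.
* `Λκ₁^{Hg} = Λκ_∞` (Rem. 4.1.4) is transcribed as `stabilizedHeegnerModule D C` for a
  `StabilizedHeegnerData` `C` = (parametrisation datum, orientation, the shift `k ↦ d(k)` pinned by
  `K_k ⊆ K[p^{d(k)}]` and minimality, the torsion depth `δ` with `d(k) = 0 ↔ k ≤ δ`, and for `k > δ`
  the two norm points `u_k = Norm_{K[p^{d(k)}]/K_k} P[p^{d(k)}]`, `v_k = Norm_{K_kK[p^{d(k)-1}]/K_k}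
  P[p^{d(k)-1}]`), the level-`k` class being `δ(κ_k) = α^{-d(k)}(δ(u_k) - α⁻¹δ(v_k))`
  (`stabilizedClassLayer`; `α = unitRoot W p`). DESIGN DECISION (the only one): the layers with
  `d(k) = 0` (`k ≤ δ`, `K_k ⊆ K[1]`), whose printed `κ_k` uses the Frobenius elements `σ_p, σ_p^*` of
  `Gal(K[1]/K)` for which the tree has no vocabulary, are NOT DESCRIBED: an element of
  `lim←_k S_p(E/K_k)` is determined by its components at any cofinal set of layers (the lower ones are
  their norms, `proj_norm`), so `Λκ_∞ = {s : pr_k(s) ∈ ℤ_p[Gal(K_k/K)]·δ(κ_k) for all k > δ}` and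
  nothing printed is lost or added. For `k > δ` one has `d(k) ≥ 2` (`K_k ⊆ K[p]` forces `K_k ⊆ K[1]`
  since `[K[p] : K[1]] = p ∓ 1` is prime to `p`), so `P[p^{d(k)}]_α = P[p^{d(k)}] - α⁻¹P[p^{d(k)-1}]` is
  the `k ≥ 1` branch of (eq:stabilized-1), and `Norm_{K[p^{d(k)}]/K_k} P[p^{d(k)-1}] =
  Norm_{K_kK[p^{d(k)-1}]/K_k} P[p^{d(k)-1}]` with NO integer factor (`K_kK[p^{d-1}] = K[p^d]` because
  `[K[p^d] : K[p^{d-1}]] = p` is prime and `K_k ⊄ K[p^{d-1}]`) — so `v_k` is the tree's compositum norm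
  `IsHeegnerNormPoint … k (p^{d(k)-1})` on the nose.
* CAUTION for consumers (module mismatch, dossier §47.3 (iii)): print bounds `char(M)` by
  `I(Λκ_∞)`, the SMALLEST natural Heegner module; for a module `ℋ' ⊇ Λκ_∞` one has `I(ℋ') ∣ I(Λκ_∞)`
  and print says nothing about `I(ℋ')`; the tree's `heegnerModule D F` of a `HeegnerFamily` (conductors
  `p^{j+1}`, compositum norms, no stabilisation) is comparable to `Λκ_∞` only through the distribution
  relations — a prover's step, not part of this fact.
* NOT typed here (no consumer; D-0026): the abstract `𝐊𝐒(𝐓, 𝓕, 𝓛)` over `R = Λ` (Def. §3.1), Thm.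
  3.2.1/3.4.1 for an arbitrary Kolyvagin system, Thm. 4.1.1 separately (its content is INSIDE 4.1.3).
  RELATED PRINT (same hypotheses, stronger conclusion, cite-level): Castella–Grossi–Skinner, Math. Ann.
  393 (2025) Thm. 6.5.2 removes the localisation at `(γ - 1)` without the corank hypothesis
  ("divides … in `Λ[1/p]`"); the tree records it at `p ∤ h_K` as
  `CastellaGrossiSkinner2025.thm652_rankOne_charIdeal_torsion_eq_sq_dvd` and, at ANY class number over
  this file's `StabilizedHeegnerData`, as
  `CastellaGrossiSkinner2025.thm652_stabilized_rankOne_charIdeal_torsion_dvd_pLocalized`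
  (file `CastellaGrossiSkinner2025/HeegnerKolyvaginBoundAnyClassNumber.lean`; cite it, do not restate).
  PROVENANCE NOTE (an ANNOTATION recording how the printed proof runs, kept under its original token
  `CGLS22-4.1.1@How04-2.3.4-almost-verbatim+CornutVatsal`; it is NOT a reading / reliability reservation
  of the literature seat that typed this file): Thm. 4.1.1 / 4.1.3 are refereed theorems (Invent. math.
  227 (2022) 517–580); their printed proof at `p ∣ h_K` is an explicit adaptation — "almost verbatim",
  with the changed points spelled out (arXiv:2008.02571 p. 22) — of Howard 2004 Lemma 2.3.4, and
  `κ₁^{Hg} ≠ 0` is imported from Cornut–Vatsal. Whether a consuming cell's census treats the token as a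
  currency flag is that cell's ruling (cell `pub/bsd-print-x9`: referee question Q-D, REF-113 (A′),
  2026-08-28), not something this file asserts.

## Galois-INCOHERENT instances of `StabilizedHeegnerData`, and what the `∀ C` facts assert there
## (referee question Q-C of cell `pub/bsd-print-x9`, REF-106 (D); literature seat g25, 2026-08-28)

Print's datum is ONE coherent CM system (`P[m] = π(x_m)` for the fixed `𝔑`, Rem. 4.1.4's `κ_k` built
from `P[p^{d(k)}]` AND `P[p^{d(k)-1}]` of that system). The structure below pins `u_k` and `v_k`
SEPARATELY through `IsHeegnerNormPoint`, which fixes a genuine Heegner point of the stated conductor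
and orientation (`heegnerForms` demands primitivity and `N ∣ A`; under (Heeg) and `p ∤ N` the level
structure is then automatic) up to the choice of the point in its `Gal(K[c]/K)`-orbit, the sum over a
transversal being independent of the transversal. So the instances of `StabilizedHeegnerData` are
exactly print's datum and its TWISTS `u_k ↦ γ^{i_k} u_k`, `v_k ↦ γ^{j_k} v_k` (`γ^{i} ∈ Gal(K_k/K)`,
independently per layer); a twist with `i_k ≢ j_k` changes the level-`k` class
`α^{-d}(u_k − α⁻¹v_k)` by `α^{-d-1}(γ^{t_k} − 1)·v_k`, not by a unit multiple in general. What the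
module `stabilizedHeegnerModule D C = {s : pr_k s ∈ ℤ_p[Gal(K_k/K)]·δ(κ_k(C)) ∀ k > δ}` is at a twist
(literature seat's analysis, cell dossier `pub/bsd-print-x9/DOSSIER.md` §52 — a SKETCH on paper, not
a tree theorem): writing `Λκ_∞` for print's module and `ω_δ = γ^{p^δ} − 1`, one has
`ω_δ · Λκ_∞ ⊆ Λκ_∞(C) ⊆ Λκ_∞` for every instance `C` (the twists move `κ_k` only modulo the
`E(K_δ)`-rational Heegner module `ℤ_p[Gal(K_δ/K)]·y_δ`, which `ω_δ` kills and which dies in the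
norm-compatible limit), with EQUALITY `Λκ_∞(C) = Λκ_∞` whenever `p ∤ h_K` (`δ = 0`) or `p` is
non-anomalous (`a_p ≢ 1 (mod p)`: the bottom norm relation `Norm_{K_{δ+1}/K_δ} κ_{δ+1} =
α⁻²(α − σ_𝔭)(α − σ_𝔭⁻¹)·y_δ` has a unit coefficient in `ℤ_p[Gal(K_δ/K)]`). CONSEQUENCE for the two
`∀ C` named facts of this file: at a twisted `C` their conclusions are IMPLIED by the printed ones
(`char(𝔖/Λκ_∞(C)) = char(𝔖/Λκ_∞)·d` with `d ∣ ω_δ`, so "`J ∣ (p^m)(T^n)·I(Λκ_∞)`" gives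
"`J ∣ (p^m)(T^n)·I(Λκ_∞(C))`"; `Λκ_∞(C) ∋ ω_δ κ_∞ ≠ 0` gives the non-vanishing and the torsion of the
quotient) — the `∀ C` typing over-RANGES print's data but never over-CLAIMS. No coherence field is
added (it would make the structure un-inhabitable from `exists_isHeegnerNormPoint` as typed, which
hides the CM point chosen); consumers who need `I(Λκ_∞(C)) = I(ℋ_F)` on the nose build `C` coherently
from ONE system and prove the comparison they use (for a coherent `C` and the tree's `HeegnerFamily`
module `ℋ_F` the same analysis gives `ℋ_F = Λκ_∞ = Λκ_∞(C)` at every class number: `κ_k ∈ ℋ_{F,k}`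
by `u_j = U_δ⁻¹(z_j + U_{δ-1} u_{j-1})` (`U_δ(a_p) ≡ a_p^δ` a unit) with the residual
`E(K_δ)`-component `−α^{-d-1} U_δ⁻¹ β^δ (U_{δ-1}/U_δ)^{k-δ-1}·w ∈ p^δ·ℤ_p[Gal(K_δ/K)]y_δ ⊆ ℋ_{F,k}`
by the Cassini identity `U_δ c'_{δ+1} − U_{δ+1} c'_δ = −(p−1)p^δ` among the coefficients
`c'_j = U_j(a_p − σ_𝔭 − σ_𝔭⁻¹) − (p−1)U_{j−1}` of `Norm_{K[p^{j+1}]/K_δ} P[p^{j+1}] = c'_j y_δ`; and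
conversely every norm-compatible system of `p`-power-conductor Heegner norms lies in `Λ·κ_∞`).

## References

* [CastellaGrossiLeeSkinner2022] Invent. Math. 227 (2022) 517–580 = arXiv:2008.02571v2: §3.2
  (L1253–1262), §3.4 + Thm. 3.4.1 + Cor. 3.4.2 (L2077–2178), §4.1 + Thm. 4.1.1 (L2180–2249), Thm. 4.1.3
  (L2253–2261), Rem. 4.1.4 (L2262–2294).
* [CastellaGrossiSkinner2025] Math. Ann. 393 (2025), Thm. 6.5.1/6.5.2 (the `(γ-1)`-free sharpening).
* [Howard2004HeegnerKolyvagin] Compositio 140 (2004), Thm. B, §2.3 (the construction adapted).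
* [PerrinRiou1987BSMF] Bull. SMF 115 (1987), §3.1 (Heegner point norm relations).
-/

noncomputable section

open scoped Classical

universe u

namespace Literature.NumberTheory.EllipticCurves.CastellaGrossiLeeSkinner2022

open WeierstrassCurve Literature.NumberTheory.EllipticCurves ModularForms

/-! ### 1. The `d(k)`-shifted `α`-stabilised Heegner datum (Thm. 4.1.1, Rem. 4.1.4) — D1-lite -/

section Data

variable (N : ℕ) [NeZero N] (W : WeierstrassCurve ℚ) (K : Type u) [Field K] [NumberField K]
  {p : ℕ} [Fact p.Prime] (κ : ZpExtension K p) (jbar : AlgebraicClosure K →+* ℂ)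

/-- **The `d(k)`-shifted Heegner datum of CGLS 2022, Thm. 4.1.1 / Rem. 4.1.4** (data + hypotheses, in
the manner of the tree's `HeegnerFamily`): a modular parametrisation datum `Dt` (`π : X₀(N) → E`) and an
orientation `β` (`β² ≡ d_K (mod 4N)`, the ideal `𝔑`), fixed throughout; the SHIFT
"`d(k) = min{d ∈ ℤ_{≥0} : K_k ⊂ K[p^d]}`" [TeX L2213–2215] (`layer_le` = `K_k ⊆ K[p^{d(k)}]`, i.e.
`Gal(K̄/K[p^{d(k)}]) ≤ Gal(K̄/K_k)`; `d_min` = minimality); the TORSION DEPTH `δ` of the anticyclotomic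
tower (`K_∞ ∩ K[1] = K_δ`, so `d(k) = 0 ↔ K_k ⊆ K[1] ↔ k ≤ δ`: field `d_eq_zero_iff`; `δ = 0` when
`p ∤ h_K`); and, for every layer `k > δ`, the norm points
`u_k = Norm_{K[p^{d(k)}]/K_k} P[p^{d(k)}] ∈ E(K_k)` and `v_k = Norm_{K_kK[p^{d(k)-1}]/K_k} P[p^{d(k)-1}]`
(`= Norm_{K[p^{d(k)}]/K_k} P[p^{d(k)-1}]`, module docstring) through the tree's `IsHeegnerNormPoint`,
from which Rem. 4.1.4's `κ_k = α^{-d(k)} Norm_{K[p^{d(k)}]/K_k}(P[p^{d(k)}] - α⁻¹P[p^{d(k)-1}])` is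
`α^{-d(k)}(u_k - α⁻¹v_k)` (`stabilizedClassLayer`). The layers `k ≤ δ` are not described (they are the
norms of the higher ones; module docstring, design decision). Nothing is asserted about existence.
LAYOUT NOTE (2026-08-28, REF Q-C of cell `pub/bsd-print-x9`): `u_k` and `v_k` are pinned SEPARATELY
(each up to its `Gal(K_k/K)`-orbit), so besides print's coherent datum the structure admits its
Galois TWISTS; see the module docstring section "Galois-INCOHERENT instances" for what the `∀ C` facts
of this file assert there (print-implied, never stronger; equality of modules off the corner
`p ∣ h_K ∧ a_p ≡ 1 (mod p)`). No coherence field (inhabitability from `exists_isHeegnerNormPoint`).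
[cite: CastellaGrossiLeeSkinner2022, Thm. 4.1.1 proof (P_k[n], d(k); arXiv v2 TeX L2213–2215) and Rem. 4.1.4 (κ_k, κ_∞; L2278–2283)] -/
structure StabilizedHeegnerData where
  /-- The modular parametrisation datum (fixes `π : X₀(N) → E`). -/
  Dt : ModularParametrizationData W N
  /-- The orientation: a residue `β` with `β² ≡ d_K (mod 4N)` (the ideal `𝔑`, `𝒪_K/𝔑 = ℤ/N`). -/
  β : ℤ
  /-- `β² ≡ d_K (mod 4N)`. -/
  dvd_sq_sub : (4 * N : ℤ) ∣ β ^ 2 - NumberField.discr K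
  /-- The shift `d(k) = min {d ≥ 0 : K_k ⊆ K[p^d]}`. -/
  d : ℕ → ℕ
  /-- `K_k ⊆ K[p^{d(k)}]`: `Gal(K̄/K[p^{d(k)}]) ≤ Gal(K̄/K_k)`. -/
  layer_le : ∀ k, ringClassSubgroup K (p ^ d k) jbar ≤ κ.layerSubgroup k
  /-- Minimality of `d(k)`: `K_k ⊄ K[p^{d'}]` for `d' < d(k)`. -/
  d_min : ∀ k d', d' < d k → ¬ ringClassSubgroup K (p ^ d') jbar ≤ κ.layerSubgroup k
  /-- The torsion depth `δ`: `K_∞ ∩ K[1] = K_δ`. -/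
  depth : ℕ
  /-- `d(k) = 0 ↔ K_k ⊆ K[1] ↔ k ≤ δ`. -/
  d_eq_zero_iff : ∀ k, d k = 0 ↔ k ≤ depth
  /-- The norm points `u_k ∈ E(K_k)` of conductor `p^{d(k)}` (meaningful for `k > δ`). -/
  u : ℕ → geomPoints (W.baseChange K)
  /-- `u_k = Norm_{K[p^{d(k)}]/K_k} P[p^{d(k)}]` for `k > δ`. -/
  isHeegnerNormPoint_u : ∀ k, depth < k → IsHeegnerNormPoint N W K κ Dt β jbar k (p ^ d k) (u k)
  /-- The norm points `v_k ∈ E(K_k)` of conductor `p^{d(k)-1}` (meaningful for `k > δ`). -/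
  v : ℕ → geomPoints (W.baseChange K)
  /-- `v_k = Norm_{K_kK[p^{d(k)-1}]/K_k} P[p^{d(k)-1}]` for `k > δ`. -/
  isHeegnerNormPoint_v : ∀ k, depth < k →
    IsHeegnerNormPoint N W K κ Dt β jbar k (p ^ (d k - 1)) (v k)

namespace StabilizedHeegnerData

variable {N W K κ jbar} (C : StabilizedHeegnerData N W K κ jbar)

/-- The bottom layer is unshifted: `d(0) = 0` (`K_0 = K ⊆ K[1]`). [cite: CastellaGrossiLeeSkinner2022, Thm. 4.1.1 proof (d(k))] -/
theorem d_zero : C.d 0 = 0 :=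
  (C.d_eq_zero_iff 0).mpr (Nat.zero_le _)

/-- Above the torsion depth the shift is positive: `0 < d(k)` for `k > δ`.
[cite: CastellaGrossiLeeSkinner2022, Thm. 4.1.1 proof (d(k))] -/
theorem d_pos_of_depth_lt {k : ℕ} (hk : C.depth < k) : 0 < C.d k := by
  rcases Nat.eq_zero_or_pos (C.d k) with h | h
  · exact absurd ((C.d_eq_zero_iff k).mp h) (not_le.mpr hk)
  · exact h

/-- `u_k` is `K_k`-rational: fixed by `Gal(K̄/K_k)` (`IsHeegnerNormPoint.smul_eq_self`; printed as
`P_k[n] ∈ E(K_k[n])`). [cite: CastellaGrossiLeeSkinner2022, Thm. 4.1.1 proof (P_k[n] ∈ E(K_k[n]), arXiv v2 TeX L2213)] -/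
theorem smul_u_eq {k : ℕ} (hk : C.depth < k) {σ : Field.absoluteGaloisGroup K}
    (hσ : σ ∈ κ.layerSubgroup k) : σ • C.u k = C.u k :=
  (C.isHeegnerNormPoint_u k hk).smul_eq_self hσ

/-- `v_k` is `K_k`-rational: fixed by `Gal(K̄/K_k)` (`IsHeegnerNormPoint.smul_eq_self`; printed as
`P_k[n] ∈ E(K_k[n])`). [cite: CastellaGrossiLeeSkinner2022, Thm. 4.1.1 proof (P_k[n] ∈ E(K_k[n]), arXiv v2 TeX L2213)] -/
theorem smul_v_eq {k : ℕ} (hk : C.depth < k) {σ : Field.absoluteGaloisGroup K}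
    (hσ : σ ∈ κ.layerSubgroup k) : σ • C.v k = C.v k :=
  (C.isHeegnerNormPoint_v k hk).smul_eq_self hσ

end StabilizedHeegnerData

end Data

/-! ### 2. The level-`k` class `δ(κ_k)`, the module `Λκ_∞ ⊆ 𝔖_p(K_∞)` and its characteristic ideal -/

section HeegnerClass

variable {N : ℕ} [NeZero N] {W : WeierstrassCurve ℚ} [W.IsGloballyMinimal] {K : Type u} [Field K]
  [NumberField K] {p : ℕ} [Fact p.Prime] {κ : ZpExtension K p} {γ : Field.absoluteGaloisGroup K}
  {jbar : AlgebraicClosure K →+* ℂ}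

/-- **The Kummer image `δ(κ_k) ∈ S_p(E/K_k)` of CGLS's level-`k` class** (Rem. 4.1.4:
`κ_k = α^{-d(k)} Norm_{K[p^{d(k)}]/K_k}(P[p^{d(k)}]_α)`, `P[p^d]_α = P[p^d] - α⁻¹P[p^{d-1}]`), for a
layer `k > δ`, as the set of its representatives inside `∏_m H¹(Gal(K̄/K_k), E[p^m])`:
`α^{-d(k)} · (δ(u_k) - α⁻¹ · δ(v_k))`, where `δ(w) = (δ_{K_k}(w))_m` is the family of Kummer classes of
`w ∈ E(K_k)` (`kummerClassOver` at every `p^m`-th root of `w`; it depends only on `w`, and roots exist),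
`α = unitRoot W p` the unit root of `x² - a_p x + p` and `α⁻¹ = Ring.inverse α` (the inverse at a good
ordinary prime), `ℤ_p` acting through `padicPi`. A set (singleton up to the choice of roots), in the
manner of `heegnerModuleLayer`, so that no module axioms on the ambient product are needed.
[cite: CastellaGrossiLeeSkinner2022, Rem. 4.1.4 (eq. stabilized-1 and κ_k, arXiv v2 TeX L2268–2283)] -/
def stabilizedClassLayer (C : StabilizedHeegnerData N W K κ jbar) (k : ℕ) (hk : C.depth < k) :
    Set (Π m : ℕ, (W.baseChange K).torsionH1Over ((p : ℤ) ^ m) (κ.layerSubgroup k)) :=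
  {x | ∃ (du dv : Π m : ℕ, (W.baseChange K).torsionH1Over ((p : ℤ) ^ m) (κ.layerSubgroup k)),
    (∀ (m : ℕ) (Q : geomPoints (W.baseChange K)) (hQ : ((p : ℤ) ^ m) • Q = C.u k),
      du m = (W.baseChange K).kummerClassOver (κ.layerSubgroup k) ((p : ℤ) ^ m) Q
        (fun σ hσ ↦ by rw [hQ]; exact C.smul_u_eq hk hσ)) ∧
    (∀ (m : ℕ) (Q : geomPoints (W.baseChange K)) (hQ : ((p : ℤ) ^ m) • Q = C.v k),
      dv m = (W.baseChange K).kummerClassOver (κ.layerSubgroup k) ((p : ℤ) ^ m) Q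
        (fun σ hσ ↦ by rw [hQ]; exact C.smul_v_eq hk hσ)) ∧
    x = (W.baseChange K).padicPi p (κ.layerSubgroup k) (Ring.inverse (unitRoot W p) ^ C.d k)
      (du - (W.baseChange K).padicPi p (κ.layerSubgroup k) (Ring.inverse (unitRoot W p)) dv)}

/-- **The level-`k` module `ℤ_p[Gal(K_k/K)] · δ(κ_k) ⊆ S_p(E/K_k)`** (`k > δ`): the additive subgroup of
`∏_m H¹(Gal(K̄/K_k), E[p^m])` generated by the elements `c · conj_{γ^i}(x)`, `c ∈ ℤ_p`, `i ∈ ℕ`, `x` a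
representative of `δ(κ_k)` (`Gal(K_k/K) = ⟨γ⟩`). A closure, as `heegnerModuleLayer`.
[cite: CastellaGrossiLeeSkinner2022, Rem. 4.1.4 (κ_k)] -/
def stabilizedModuleLayer (γ : Field.absoluteGaloisGroup K) (C : StabilizedHeegnerData N W K κ jbar)
    (k : ℕ) (hk : C.depth < k) :
    AddSubgroup (Π m : ℕ, (W.baseChange K).torsionH1Over ((p : ℤ) ^ m) (κ.layerSubgroup k)) :=
  AddSubgroup.closure {y | ∃ (c : ℤ_[p]) (i : ℕ)
    (x : Π m : ℕ, (W.baseChange K).torsionH1Over ((p : ℤ) ^ m) (κ.layerSubgroup k)),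
    x ∈ stabilizedClassLayer C k hk ∧
    y = (W.baseChange K).padicPi p (κ.layerSubgroup k) c
      ((W.baseChange K).conjPi p (κ.layerSubgroup k) (γ ^ i) x)}

variable (D : (W.baseChange K).LambdaAdicSelmerData κ γ) (C : StabilizedHeegnerData N W K κ jbar)

/-- **The `Λ`-adic Heegner class module `Λκ_∞ = Λκ₁^{Hg} ⊆ H¹_{𝓕_Λ}(K, 𝐓) ∼ 𝔖_p(K_∞)`** (Rem. 4.1.4:
"`κ_∞ := lim←_k δ(κ_k)` … `κ_∞` and `κ₁^{Hg}` generate the same `Λ`-submodule of `H¹_{𝓕_Λ}(K, 𝐓)`"): the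
`Λ`-span of the elements of `D.S` whose projection to every layer `k` ABOVE the torsion depth lies in
`ℤ_p[Gal(K_k/K)]·δ(κ_k)` (`stabilizedModuleLayer`). Since the family `(δ(κ_k))_k` is norm-compatible
(printed) and an element of `lim← S_p(E/K_k)` is determined by its components at a cofinal set of
layers, this is `lim←_{k>δ} ℤ_p[Gal(K_k/K)]·δ(κ_k) = Λκ_∞`.
[cite: CastellaGrossiLeeSkinner2022, Rem. 4.1.4 (κ_∞ and "generate the same Λ-submodule", arXiv v2 TeX L2278–2291)] -/
def stabilizedHeegnerModule : Submodule (IwasawaAlgebra p) D.S :=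
  Submodule.span (IwasawaAlgebra p)
    {s | ∀ (k : ℕ) (hk : C.depth < k), D.proj k s ∈ stabilizedModuleLayer γ C k hk}

/-- **`I(Λκ_∞) = char_Λ(H¹_{𝓕_Λ}(K, 𝐓)/Λκ₁^{Hg})`**, the right-hand side of Thm. 4.1.3 (ii), through the
tree's `Module.charIdeal` — the `d(k)`-shifted analogue of `heegnerCharIdeal`.
[cite: CastellaGrossiLeeSkinner2022, Thm. 4.1.3 (ii)] -/
def stabilizedHeegnerCharIdeal : Ideal (IwasawaAlgebra p) :=
  Module.charIdeal (IwasawaAlgebra p) (D.S ⧸ stabilizedHeegnerModule D C)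

/-- Unfolding of `stabilizedHeegnerCharIdeal` (`I(Λκ_∞) = char_Λ(H¹_{𝓕_Λ}(K,𝐓)/Λκ₁^{Hg})`).
[cite: CastellaGrossiLeeSkinner2022, Thm. 4.1.3 (ii)] -/
theorem stabilizedHeegnerCharIdeal_def : stabilizedHeegnerCharIdeal D C =
    Module.charIdeal (IwasawaAlgebra p) (D.S ⧸ stabilizedHeegnerModule D C) :=
  rfl

/-- An element of `𝔖_p(K_∞)` all of whose projections above the torsion depth lie in the level modules
of `δ(κ_k)` belongs to `Λκ_∞` (it is one of the spanning elements; printed: `κ_∞ := lim←_k δ(κ_k)`).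
[cite: CastellaGrossiLeeSkinner2022, Rem. 4.1.4 (κ_∞, arXiv v2 TeX L2278–2283)] -/
theorem mem_stabilizedHeegnerModule_of_proj_mem {s : D.S}
    (hs : ∀ (k : ℕ) (hk : C.depth < k), D.proj k s ∈ stabilizedModuleLayer γ C k hk) :
    s ∈ stabilizedHeegnerModule D C :=
  Submodule.subset_span hs

end HeegnerClass

/-! ### 3. The standing hypotheses of §3.2 + §4.1, as a `Prop`-structure (shape of `Thm652Hypotheses`) -/

section Facts

variable (N : ℕ) [NeZero N] (W : WeierstrassCurve ℚ) [W.IsGloballyMinimal] (K : Type u) [Field K]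
  [NumberField K] (p : ℕ) [Fact p.Prime] (κ : ZpExtension K p) (γ : Field.absoluteGaloisGroup K)

/-- **Hypotheses of CGLS 2022, Theorem 4.1.3** = the §3.2 standing hypotheses [TeX L1253–1258] "`E/ℚ` an
elliptic curve of conductor `N`, `p ∤ 2N` a prime of good ordinary reduction for `E`, `K` an imaginary
quadratic field of discriminant `D_K` prime to `Np`, (h1) `E(K)[p] = 0`" + the §4.1 standing
hypotheses [L2186] "(Heeg) and (disc)" under which `κ^{Hg}` is built + `κ` the anticyclotomic
`ℤ_p`-extension [L1260] with topological generator `γ` [L2117] — field by field, in the spelling of the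
tree's `CastellaGrossiSkinner2025.Thm652Hypotheses` WITHOUT its extra `p ∤ h_K`. NO hypothesis on the
Galois image of `E[p]` beyond (h1), none on the splitting of `p` in `K`, none on the class number of
`K`, none on parity or Selmer corank (the corank enters only the "Moreover" clause, as a premiss there).
(`D_K` prime to `N` follows from (Heeg): split primes are unramified.)
[cite: CastellaGrossiLeeSkinner2022, §3.2 standing (arXiv v2 TeX L1253–1260), §4.1 standing (L2186), (Heeg) (L211–212), (disc) (L248–249)] -/
structure Thm413Hypotheses : Prop where
  /-- `E` is an elliptic curve. -/
  isElliptic : W.IsElliptic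
  /-- `N` is the conductor of `E` ("of conductor `N`"; the level of `P[m] = π(x_m)`, `π : X₀(N) → E`). -/
  level : N = W.conductorNorm ℤ
  /-- `p ∤ 2`. -/
  p_ne_two : p ≠ 2
  /-- `p ∤ N` and good ORDINARY reduction at `p`. -/
  ordinary : IsOrdinaryAt W p
  /-- `K` is imaginary quadratic. -/
  isImaginaryQuadratic : IsImaginaryQuadratic K
  /-- `D_K` is prime to `p`. -/
  not_dvd_discr : ¬ (p : ℤ) ∣ NumberField.discr K
  /-- (h1): `E(K)[p] = 0`. -/
  noPTorsion : ∀ Q : (W.baseChange K).toAffine.Point, p • Q = 0 → Q = 0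
  /-- (Heeg): every prime dividing `N` splits in `K`. -/
  heegner : SatisfiesHeegnerHypothesis N K
  /-- (disc), first half: `D_K` is odd. -/
  discr_odd : Odd (NumberField.discr K)
  /-- (disc), second half: `D_K ≠ -3`. -/
  discr_ne : NumberField.discr K ≠ -3
  /-- `κ` is the anticyclotomic `ℤ_p`-extension of `K`. -/
  anticyclotomic : κ.IsAnticyclotomic
  /-- `γ` is a topological generator of `Γ = Gal(K_∞/K)`. -/
  topGenerator : κ.IsTopGenerator γ

variable {N W K p κ γ} in
omit [NeZero N] in
/-- The hypotheses make `p` odd and of good ordinary reduction (bookkeeping with `isOrdinaryAt_iff`).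
[cite: CastellaGrossiLeeSkinner2022, §3.2 standing] -/
theorem Thm413Hypotheses.two_lt (hyp : Thm413Hypotheses N W K p κ γ) : 2 < p := by
  have h2 := (Fact.out : p.Prime).two_le
  have hne := hyp.p_ne_two
  omega

/-! ### 4. Theorem 4.1.3 as a named fact (shape of `Howard2004_thmB` / `thm652_…`) -/

/-- **Castella–Grossi–Lee–Skinner, Invent. Math. 227 (2022), Theorem 4.1.3** (arXiv:2008.02571v2 TeX
`thm:howard-HP`, L2253–2261), verbatim: "Assume `E(K)[p] = 0`. Then the module `H¹_{𝓕_Λ}(K, 𝐓)` has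
`Λ`-rank one, and there is a finitely generated torsion `Λ`-module `M` such that (i) `𝒳 ∼ Λ ⊕ M ⊕ M`,
(ii) `char_Λ(M)` divides `char_Λ(H¹_{𝓕_Λ}(K, 𝐓)/Λκ₁^{Hg})` in `Λ[1/p, 1/(γ-1)]`. Moreover, if
`H¹_𝓕(K, E[p^∞])` has `ℤ_p`-corank one, then `char_Λ(M)` divides `char_Λ(H¹_{𝓕_Λ}(K, 𝐓)/Λκ₁^{Hg})` in
`Λ[1/p]`" — under the §3.2 + §4.1 standing hypotheses (`Thm413Hypotheses`: NO image hypothesis beyond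
(h1), ANY class number of `K`), with `Λκ₁^{Hg} = Λκ_∞` the `d(k)`-shifted `α`-stabilised Heegner class
module of Rem. 4.1.4 (`stabilizedHeegnerModule D C`, so `char_Λ(H¹_{𝓕_Λ}/Λκ₁^{Hg}) =
stabilizedHeegnerCharIdeal D C`). Recorded, for every `Λ`-adic Selmer datum `D` (`H¹_{𝓕_Λ}(K,𝐓)`),
stabilised Heegner datum `C` at level `N = N_E` and Selmer-dual datum `X` (`𝒳`), through invariants of
the printed pseudo-isomorphism (WEAKER, never stronger): `D.S` and `X.X` finitely generated of `Λ`-rank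
one; there are an ideal `J ⊆ Λ` (`= char_Λ(M)`) and `m n ∈ ℕ` with `char_Λ(𝒳_{Λ-tors}) = J²` ((i)) and
`J ∣ (p^m)·(T^n)·I(Λκ_∞)` ((ii); `T = γ - 1`); and if `corank_{ℤ_p} Sel_{p^∞}(E/K) = 1` then
`J ∣ (p^{m'})·I(Λκ_∞)` for some `m'` (the "Moreover" clause = Cor. 3.4.2 applied to `κ^{Hg}`). PUBLISHED
THEOREM (Invent. math. 227 (2022) 517–580); provenance note (ANNOTATION, see the module docstring — not a
reading reservation) `CGLS22-4.1.1@How04-2.3.4-almost-verbatim+CornutVatsal` (the Kolyvagin system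
at `p ∣ h_K` is printed as an "almost verbatim" adaptation of Howard's Lemma 2.3.4; `κ₁^{Hg} ≠ 0` by
Cornut–Vatsal). The `(γ-1)`-free sharpening under the same hypotheses is Castella–Grossi–Skinner 2025
Thm. 6.5.2 (tree: `CastellaGrossiSkinner2025.thm652_rankOne_charIdeal_torsion_eq_sq_dvd` at `p ∤ h_K`;
`CastellaGrossiSkinner2025.thm652_stabilized_rankOne_charIdeal_torsion_dvd_pLocalized` at any class
number over this file's `StabilizedHeegnerData`). A `Prop`; nothing
asserted. [cite: CastellaGrossiLeeSkinner2022, Thm. 4.1.3 (arXiv v2 TeX L2253–2261) with Thm. 3.4.1 / Cor. 3.4.2 (L2119–2178), Thm. 4.1.1 (L2203–2249) and Rem. 4.1.4 (L2262–2294); §3.2/§4.1 standing hypotheses]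
[cite: CastellaGrossiSkinner2025, Thm. 6.5.2 (the sharpening; §6.5 identification of the modules)] -/
def thm413_rankOne_charIdeal_torsion_dvd_localized : Prop :=
  ∀ (N : ℕ) [NeZero N] (W : WeierstrassCurve ℚ) [W.IsGloballyMinimal]
    (K : Type u) [Field K] [NumberField K] (p : ℕ) [Fact p.Prime] (κ : ZpExtension K p)
    (γ : Field.absoluteGaloisGroup K) (jbar : AlgebraicClosure K →+* ℂ),
    Thm413Hypotheses N W K p κ γ →
    ∀ (D : (W.baseChange K).LambdaAdicSelmerData κ γ) (C : StabilizedHeegnerData N W K κ jbar)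
      (X : (W.baseChange K).SelmerDualData κ γ),
      (Module.Finite (IwasawaAlgebra p) D.S ∧ Module.finrank (IwasawaAlgebra p) D.S = 1) ∧
      (Module.Finite (IwasawaAlgebra p) X.X ∧ Module.finrank (IwasawaAlgebra p) X.X = 1 ∧
        ∃ (J : Ideal (IwasawaAlgebra p)) (m n : ℕ),
          Module.charIdeal (IwasawaAlgebra p) (Submodule.torsion (IwasawaAlgebra p) X.X) = J ^ 2 ∧
          J ∣ Ideal.span {(p : IwasawaAlgebra p) ^ m} *
            Ideal.span {(PowerSeries.X : IwasawaAlgebra p) ^ n} * stabilizedHeegnerCharIdeal D C ∧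
          ((W.baseChange K).selmerCorank p = 1 →
            ∃ m' : ℕ, J ∣ Ideal.span {(p : IwasawaAlgebra p) ^ m'} * stabilizedHeegnerCharIdeal D C))

/-! ### 5. Kernel bookkeeping: the two shapes consumers ask for -/

variable {N W K p κ γ} {jbar : AlgebraicClosure K →+* ℂ}

/-- **Thm. 4.1.3 (i)+(ii) in the "containment in `Λ[1/p, 1/T]`" shape**: there are `m n` with
`char_Λ(𝒳_{Λ-tors}) ∣ (p^m)(T^n)·I(Λκ_∞)²` — Howard's `char(X_tors) ∣ I(ℋ)²` weakened by the powers
of `p` and `T = γ - 1`, WITHOUT any Galois-image or class-number hypothesis.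
[cite: CastellaGrossiLeeSkinner2022, Thm. 4.1.3 (i)–(ii)] -/
theorem charIdeal_torsion_dvd_localized_of_thm413 (h : thm413_rankOne_charIdeal_torsion_dvd_localized.{u})
    (hyp : Thm413Hypotheses N W K p κ γ) (D : (W.baseChange K).LambdaAdicSelmerData κ γ)
    (C : StabilizedHeegnerData N W K κ jbar) (X : (W.baseChange K).SelmerDualData κ γ) :
    ∃ m n : ℕ, Module.charIdeal (IwasawaAlgebra p) (Submodule.torsion (IwasawaAlgebra p) X.X) ∣
      Ideal.span {(p : IwasawaAlgebra p) ^ m} * Ideal.span {(PowerSeries.X : IwasawaAlgebra p) ^ n} *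
        stabilizedHeegnerCharIdeal D C ^ 2 := by
  obtain ⟨-, -, -, J, m, n, hJ, hdvd, -⟩ := h N W K p κ γ jbar hyp D C X
  refine ⟨m * 2, n * 2, ?_⟩
  have h2 := pow_dvd_pow_of_dvd hdvd 2
  rw [mul_pow, mul_pow, Ideal.span_singleton_pow, Ideal.span_singleton_pow, ← pow_mul, ← pow_mul] at h2
  rwa [hJ]

/-- **The "Moreover" clause (= Cor. 3.4.2 for `κ^{Hg}`) in the "containment in `Λ[1/p]`" shape**: at
`corank_{ℤ_p} Sel_{p^∞}(E/K) = 1` there is `m` with `char_Λ(𝒳_{Λ-tors}) ∣ (p^m)·I(Λκ_∞)²` — `p`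
inverted ONLY. [cite: CastellaGrossiLeeSkinner2022, Thm. 4.1.3 ("Moreover") and Cor. 3.4.2] -/
theorem charIdeal_torsion_dvd_pLocalized_of_thm413 (h : thm413_rankOne_charIdeal_torsion_dvd_localized.{u})
    (hyp : Thm413Hypotheses N W K p κ γ) (hrk : (W.baseChange K).selmerCorank p = 1)
    (D : (W.baseChange K).LambdaAdicSelmerData κ γ) (C : StabilizedHeegnerData N W K κ jbar)
    (X : (W.baseChange K).SelmerDualData κ γ) :
    ∃ m : ℕ, Module.charIdeal (IwasawaAlgebra p) (Submodule.torsion (IwasawaAlgebra p) X.X) ∣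
      Ideal.span {(p : IwasawaAlgebra p) ^ m} * stabilizedHeegnerCharIdeal D C ^ 2 := by
  obtain ⟨-, -, -, J, -, -, hJ, -, hmore⟩ := h N W K p κ γ jbar hyp D C X
  obtain ⟨m', hdvd⟩ := hmore hrk
  refine ⟨m' * 2, ?_⟩
  have h2 := pow_dvd_pow_of_dvd hdvd 2
  rw [mul_pow, Ideal.span_singleton_pow, ← pow_mul] at h2
  rwa [hJ]

/-- **Containment form** (the shape of the line stubs `stub_depthPos_localized`): a divisibility of
ideals `char ∣ (p^m)·I²` gives the inclusion `(p^m)·I² ≤ char` (`Ideal.le_of_dvd`).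
[cite: CastellaGrossiLeeSkinner2022, Thm. 4.1.3 ("Moreover")] -/
theorem span_pow_mul_sq_le_charIdeal_torsion_of_thm413
    (h : thm413_rankOne_charIdeal_torsion_dvd_localized.{u})
    (hyp : Thm413Hypotheses N W K p κ γ) (hrk : (W.baseChange K).selmerCorank p = 1)
    (D : (W.baseChange K).LambdaAdicSelmerData κ γ) (C : StabilizedHeegnerData N W K κ jbar)
    (X : (W.baseChange K).SelmerDualData κ γ) :
    ∃ m : ℕ, Ideal.span {(p : IwasawaAlgebra p) ^ m} * stabilizedHeegnerCharIdeal D C ^ 2 ≤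
      Module.charIdeal (IwasawaAlgebra p) (Submodule.torsion (IwasawaAlgebra p) X.X) := by
  obtain ⟨m, hm⟩ := charIdeal_torsion_dvd_pLocalized_of_thm413 h hyp hrk D C X
  exact ⟨m, Ideal.le_of_dvd hm⟩

/-! ### 6. Theorem 4.1.1 with §3.3's torsion-freeness: `Λκ_∞ ≠ 0`, `𝔖` torsion-free, `𝔖/Λκ_∞`
torsion — the named fact the cell's envelope stubs asked for (WANTED x9-p2, 2026-08-28) -/

variable (N W K p κ γ) in
/-- **Castella–Grossi–Lee–Skinner, Invent. Math. 227 (2022), Theorem 4.1.1 with Remark 4.1.4 and the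
standing torsion-freeness of §3.3–3.4** — the quotient `H¹_{𝓕_Λ}(K, 𝐓)/Λκ₁^{Hg}` IS A TORSION
`Λ`-MODULE, at ANY class number, under `E(K)[p] = 0` alone. Verbatim: Thm. 4.1.1 [TeX L2203–2206]
"Assume `E(K)[p] = 0`. Then there exists a Kolyvagin system `κ^{Hg} ∈ 𝐊𝐒(𝐓, 𝓕_Λ, 𝓛_E)` such that
`κ₁^{Hg} ∈ H¹_{𝓕_Λ}(K, 𝐓)` is nonzero" (proof: "that `κ₁^{Hg}` is nonzero follows from the works of
Cornut and Vatsal"); Rem. 4.1.4 [L2291–2294] "`κ_∞` and `κ₁^{Hg}` generate the same `Λ`-submodule of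
`H¹_{𝓕_Λ}(K, 𝐓)`"; §3.3, proof of Thm. 3.3.1 [arXiv p0017 L114, p0018 L3/L8] "The assumption `T̄^{G_K} = 0`
implies that `H¹_𝓕(K, T)` is torsion-free", used for `𝐓` through the specialisations of Thm. 3.4.1's
proof [p0021 L12–L21], which then takes "a characteristic power series `f_Λ` for
`H¹_{𝓕_Λ}(K, 𝐓)/Λκ₁`" — i.e. treats that quotient as torsion (the same torsion-freeness of the
`Λ`-adic Selmer module under `H⁰(G_K, ρ̄₀) = 0`, "since `Gal(K_∞/K)` is pro-`p` … by [PR94, §1.3.3]", is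
the first sentence of the proof of Burungale–Castella–Kim 2021 Thm. 5.2, arXiv:1908.09512v2 TeX l.1060).
Recorded, under `Thm413Hypotheses` (the §3.2 + §4.1 standing hypotheses: `p ∤ 2N` good ordinary,
`D_K` prime to `p`, (h1), (Heeg), (disc), `κ` anticyclotomic with generator `γ`; NO image, splitting,
class-number or corank hypothesis), for every `Λ`-adic Selmer datum `D` and stabilised Heegner datum
`C` at level `N = N_E`: `D.S` has no `Λ`-torsion (`NoZeroSMulDivisors`), `Λκ_∞ =
stabilizedHeegnerModule D C ≠ ⊥`, and `D.S ⧸ stabilizedHeegnerModule D C` is `Λ`-torsion — the three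
clauses being (§3.3 torsion-freeness) ∧ (Thm. 4.1.1 + Rem. 4.1.4) ∧ (their conjunction with the
`Λ`-rank one of Thm. 4.1.3 (i)). At a Galois-twisted instance `C` (module docstring) all three are
implied by the printed ones (`Λκ_∞(C) ⊇ ω_δ·Λκ_∞`). PUBLISHED (Invent. math. 227 (2022)); provenance
note (ANNOTATION, see the module docstring — not a reading reservation)
`CGLS22-4.1.1@How04-2.3.4-almost-verbatim+CornutVatsal`; a `Prop`, nothing asserted.
[cite: CastellaGrossiLeeSkinner2022, Thm. 4.1.1 (arXiv v2 TeX L2203–2249), Rem. 4.1.4 (L2262–2294), §3.3 proof of Thm. 3.3.1 (arXiv:2008.02571 p0017 L114, p0018 L3–L8), proof of Thm. 3.4.1 (p0021 L12–L21), Thm. 4.1.3 (i) (L2253–2261)]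
[cite: BurungaleCastellaKim2021, proof of Thm. 5.2, first sentence (arXiv:1908.09512v2 TeX l.1060: torsion-freeness of the Λ-adic module under H⁰(G_K, ρ̄₀) = 0, via [PR94, §1.3.3])]
[cite: Howard2004HeegnerKolyvagin, Thm. 2.3.1 and Lemma 2.3.4 (the construction adapted)] -/
def thm411_torsionFree_heegnerClass_ne_bot_quotient_isTorsion : Prop :=
  ∀ (N : ℕ) [NeZero N] (W : WeierstrassCurve ℚ) [W.IsGloballyMinimal]
    (K : Type u) [Field K] [NumberField K] (p : ℕ) [Fact p.Prime] (κ : ZpExtension K p)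
    (γ : Field.absoluteGaloisGroup K) (jbar : AlgebraicClosure K →+* ℂ),
    Thm413Hypotheses N W K p κ γ →
    ∀ (D : (W.baseChange K).LambdaAdicSelmerData κ γ) (C : StabilizedHeegnerData N W K κ jbar),
      NoZeroSMulDivisors (IwasawaAlgebra p) D.S ∧
      stabilizedHeegnerModule D C ≠ ⊥ ∧
      Module.IsTorsion (IwasawaAlgebra p) (D.S ⧸ stabilizedHeegnerModule D C)

/-- **`𝔖/Λκ_∞` is torsion** (the clause the envelope/comparison stubs consume: with it `Module.charIdeal`
of the quotient is the honest `char_Λ`, not the junk value `⊤` of a non-torsion module).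
[cite: CastellaGrossiLeeSkinner2022, Thm. 4.1.1 + Rem. 4.1.4 + Thm. 4.1.3 (i) with §3.3 torsion-freeness] -/
theorem isTorsion_quotient_stabilizedHeegnerModule_of_thm411
    (h : thm411_torsionFree_heegnerClass_ne_bot_quotient_isTorsion.{u})
    (hyp : Thm413Hypotheses N W K p κ γ) (D : (W.baseChange K).LambdaAdicSelmerData κ γ)
    (C : StabilizedHeegnerData N W K κ jbar) :
    Module.IsTorsion (IwasawaAlgebra p) (D.S ⧸ stabilizedHeegnerModule D C) :=
  (h N W K p κ γ jbar hyp D C).2.2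

/-- **`Λκ_∞ ≠ 0`** (Thm. 4.1.1: `κ₁^{Hg} ≠ 0`, Cornut–Vatsal; Rem. 4.1.4: same submodule as `Λκ_∞`).
[cite: CastellaGrossiLeeSkinner2022, Thm. 4.1.1 (arXiv v2 TeX L2203–2206) and Rem. 4.1.4 (L2291–2294)] -/
theorem stabilizedHeegnerModule_ne_bot_of_thm411
    (h : thm411_torsionFree_heegnerClass_ne_bot_quotient_isTorsion.{u})
    (hyp : Thm413Hypotheses N W K p κ γ) (D : (W.baseChange K).LambdaAdicSelmerData κ γ)
    (C : StabilizedHeegnerData N W K κ jbar) :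
    stabilizedHeegnerModule D C ≠ ⊥ :=
  (h N W K p κ γ jbar hyp D C).2.1

/-- **`𝔖 = H¹_{𝓕_Λ}(K, 𝐓)` has no `Λ`-torsion** under `E(K)[p] = 0` (§3.3: "`T̄^{G_K} = 0` implies
that `H¹_𝓕(K, T)` is torsion-free"; BCK21, proof of Thm. 5.2, first sentence).
[cite: CastellaGrossiLeeSkinner2022, §3.3 proof of Thm. 3.3.1 (arXiv:2008.02571 p0017 L114)]
[cite: BurungaleCastellaKim2021, proof of Thm. 5.2, first sentence (arXiv:1908.09512v2 TeX l.1060)] -/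
theorem noZeroSMulDivisors_selmer_of_thm411
    (h : thm411_torsionFree_heegnerClass_ne_bot_quotient_isTorsion.{u})
    (hyp : Thm413Hypotheses N W K p κ γ) (jbar : AlgebraicClosure K →+* ℂ)
    (D : (W.baseChange K).LambdaAdicSelmerData κ γ) (C : StabilizedHeegnerData N W K κ jbar) :
    NoZeroSMulDivisors (IwasawaAlgebra p) D.S :=
  (h N W K p κ γ jbar hyp D C).1

/-- **Monotonicity made usable**: for a submodule `H ⊇ Λκ_∞(C)` of `𝔖` (e.g. a module shown to contain
the stabilised class), the quotient `𝔖/H` is torsion as well (a quotient of the torsion module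
`𝔖/Λκ_∞(C)`), so its `Module.charIdeal` is honest and `char(𝔖/H) ∣ char(𝔖/Λκ_∞(C))`-type comparisons
are available to the envelope stubs. [cite: CastellaGrossiLeeSkinner2022, Thm. 4.1.1 + Rem. 4.1.4 (Λκ_∞ ≠ 0) with Thm. 4.1.3 (i)] -/
theorem isTorsion_quotient_of_stabilizedHeegnerModule_le_of_thm411
    (h : thm411_torsionFree_heegnerClass_ne_bot_quotient_isTorsion.{u})
    (hyp : Thm413Hypotheses N W K p κ γ) (D : (W.baseChange K).LambdaAdicSelmerData κ γ)
    (C : StabilizedHeegnerData N W K κ jbar) {H : Submodule (IwasawaAlgebra p) D.S}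
    (hle : stabilizedHeegnerModule D C ≤ H) :
    Module.IsTorsion (IwasawaAlgebra p) (D.S ⧸ H) := by
  intro x
  obtain ⟨y, rfl⟩ := Submodule.Quotient.mk_surjective H x
  have hT : Module.IsTorsion (IwasawaAlgebra p) (D.S ⧸ stabilizedHeegnerModule D C) :=
    isTorsion_quotient_stabilizedHeegnerModule_of_thm411 h hyp D C
  obtain ⟨⟨r, hr⟩, hry⟩ := @hT (Submodule.Quotient.mk y)
  refine ⟨⟨r, hr⟩, ?_⟩
  rw [Submonoid.mk_smul] at hry ⊢
  rw [← Submodule.Quotient.mk_smul, Submodule.Quotient.mk_eq_zero] at hry ⊢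
  exact hle hry

end Facts

end Literature.NumberTheory.EllipticCurves.CastellaGrossiLeeSkinner2022

end
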